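import Summits.Ventures.GridStability.Models.InverterDVOC

/-!
# GridStability/Models/InverterDVOCNetwork — multi-converter dVOC network, quasi-steady-state reduced model `f^s_v̂`

Cell `gridfusion` (LADDER-GRIDFUSION, rung G3 «inverter models» = APEX LINE, director RULINGS 3 (1);
seat model-3; `plan/PARTITION.md` §0 row `Models/`). THREE COLUMNS: MODELLED column only — the
printed reduced-order model of `N` converters under dispatchable virtual oscillator control (dVOC)
coupled through a quasi-steady-state network, typed AS PRINTED on top of the one-converter block
`InverterDVOC.Dvoc` (p459525), with the structural facts an SOS certificate needs (NATIVELY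
POLYNOMIAL, cubic, NO algebraic constraint; rotational symmetry; rest points = power set-point
tracking at nominal voltage). No declaration says that any converter or grid is stable; the printed
almost-global stability THEOREM of the source is quoted by locator, not asserted as a Lean fact.

## Source (read on the page; LaTeX extraction keeps the equation labels)

[cite: SuboticEtAl2021] I. Subotić, D. Groß, M. Colombino, F. Dörfler, *A Lyapunov framework for
nested dynamical systems on multiple time scales with application to converter-based power systems*,
IEEE TAC 66 (2021) 5909–5924 = arXiv:1911.08945 [corpus:paper:arxiv-1911.08945]:
* §II notation (chunk p0004): `R(θ) = [[cos θ, −sin θ], [sin θ, cos θ]]`, `J := R(π/2)` «an embedding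
  of the complex imaginary unit into ℝ²», `M_n = I_n ⊗ M`;
* §V-A (chunk p0014): `N_c` converters, converter terminal voltages `v_k ∈ ℝ²` in a global `dq` frame
  rotating at `ω₀`; network admittance matrix `𝒴 := ℬ Z_T⁻¹ ℬᵀ` with `Z_T = R_T + ω₀ J L_T`
  (so every 2×2 block of `𝒴` is of the form `a I₂ + c J`); §V-B: injections `p_k := v_kᵀ i_{o,k}`,
  `q_k := v_kᵀ J i_{o,k}`, `i_o = ℬ i_t`;
* §VI-A (chunk p0016) eq. (closed.loop.r.f.hatv): `d/dt v̂ = η (𝒦 v̂ − ℛ(κ) ℬ i_t + η_a Φ(v̂) v̂)`,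
  `𝒦 = diag(K_k)`, `K_k = (1/v_k*²) R(κ) [[p_k*, q_k*], [−q_k*, p_k*]]`, `Φ_k(v̂_k) = 1 − ‖v̂_k‖²/v_k*²`,
  `κ = tan⁻¹(ω₀ ρ)` (Assumption 3, uniform `ℓ/r = ρ`); «the term `K_k v_k − R(κ) i_{o,k}` can be
  interpreted in terms of power set-point tracking»;
* §VI-C (chunk p0017) eq. (ss.f.vhat): the REDUCED-ORDER model
  `f^s_v̂(v̂) := η (𝒦 v̂ − ℛ(κ) 𝒴 v̂ + η_a Φ(v̂) v̂)`, «obtained by assuming that the inner controls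
  perfectly track their reference and that the transmission line dynamics are negligible … This is
  the setup considered in [Colombino et al. 2019]»; printed ADEQUACY window for this reduction:
  Condition 4 (η small against the line time constant ρ, chunk p0017), Conditions 5–6 (inner PI
  gains), Theorem 6 (chunk p0018) — quoted in MODEL-VALIDITY MV-6O, NOT typed as a fact here.

## What is typed, and the SOS verdict

`DvocNetwork N` (gains, set-points, the block-complex admittance `𝒴 ↔ (Yre, Yim)`), the network
current `(𝒴 v̂)_k`, the field `f^s` built from `Dvoc.dv₁/dv₂` (verbatim reuse of the one-converter
block with `i_{o,k} := (𝒴 v̂)_k`), injections `p_k, q_k`, solutions. PROVED: (i) `power_of_tracking`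
— `R(κ) i = K_k v` forces `vᵀ i = p_k* ‖v‖²/v_k*²`, `vᵀ J i = q_k* ‖v‖²/v_k*²`, hence at a rest
configuration with `Φ_k = 0` the model delivers exactly `(p_k*, q_k*)` at `‖v̂_k‖ = v_k*`
(`rest_point`, `power_at_rest`); (ii) `field_rotate` — `f^s(ℛ(θ) v̂) = ℛ(θ) f^s(v̂)`: equilibria are
circles in the static frame, so a certificate must be stated for the orbit SET / in a co-rotating or
relative frame (the dVOC analogue of the reference-angle reduction). VERDICT: polynomial vector field
of degree 3 on `ℝ^{2N}`, NO equality constraints, `2N` variables; dense Gram basis for `−V̇` at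
`V`-degree 2: `C(2N+2, 2)` (N = 3: 28, N = 5: 66, N = 10: 231) — versus `4N` variables + `N`
constraints, degree 4 for the droop microgrid with voltage dynamics (`InverterNetwork.lean`).
No parameter values (model-4 custody).
-/

noncomputable section

open Real Finset

namespace Summit.Ventures.GridStability.Models.InverterDVOC

/-! ## §0 One-converter complement: power delivered under set-point tracking -/

namespace Dvoc

variable (O : Dvoc)

/-- **Power set-point tracking** («the term `K_k v_k − R(κ) i_{o,k}` can be interpreted in terms of
power set-point tracking», [cite: SuboticEtAl2021, §VI-A]) made exact: if the output current
satisfies `R(κ) i = K v` (componentwise the hypotheses `h₁`, `h₂`, as in `rest_point`), then the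
injections `p = vᵀ i` and `q = vᵀ J i` ([cite: SuboticEtAl2021, §V-B]) equal
`p* ‖v‖²/v*²` and `q* ‖v‖²/v*²` — the set-points scaled by the squared voltage ratio. Pure algebra
(`R(κ)` orthogonal). -/
theorem power_of_tracking {v₁ v₂ i₁ i₂ : ℝ}
    (h₁ : cos O.κ * i₁ - sin O.κ * i₂ = O.Kv₁ v₁ v₂)
    (h₂ : sin O.κ * i₁ + cos O.κ * i₂ = O.Kv₂ v₁ v₂) :
    v₁ * i₁ + v₂ * i₂ = O.pref * (v₁ ^ 2 + v₂ ^ 2) / O.vref ^ 2 ∧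
      v₂ * i₁ - v₁ * i₂ = O.qref * (v₁ ^ 2 + v₂ ^ 2) / O.vref ^ 2 := by
  have sc := sin_sq_add_cos_sq O.κ
  simp only [Kv₁, Kv₂] at h₁ h₂
  constructor
  · linear_combination (v₁ * cos O.κ - v₂ * sin O.κ) * h₁ + (v₁ * sin O.κ + v₂ * cos O.κ) * h₂
      + (1 / O.vref ^ 2 * (v₁ * (O.pref * v₁ + O.qref * v₂) + v₂ * (-(O.qref * v₁) + O.pref * v₂))
        - v₁ * i₁ - v₂ * i₂) * sc
  · linear_combination (v₂ * cos O.κ + v₁ * sin O.κ) * h₁ + (v₂ * sin O.κ - v₁ * cos O.κ) * h₂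
      + (1 / O.vref ^ 2 * (v₂ * (O.pref * v₁ + O.qref * v₂) - v₁ * (-(O.qref * v₁) + O.pref * v₂))
        - v₂ * i₁ + v₁ * i₂) * sc

/-- At nominal magnitude (`Φ(v) = 0`, i.e. `‖v‖ = v*`, `v* ≠ 0`) set-point tracking delivers EXACTLY
the set-points: `p = p*`, `q = q*`. -/
theorem power_at_rest (hv : O.vref ≠ 0) {v₁ v₂ i₁ i₂ : ℝ} (hΦ : O.phi v₁ v₂ = 0)
    (h₁ : cos O.κ * i₁ - sin O.κ * i₂ = O.Kv₁ v₁ v₂)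
    (h₂ : sin O.κ * i₁ + cos O.κ * i₂ = O.Kv₂ v₁ v₂) :
    v₁ * i₁ + v₂ * i₂ = O.pref ∧ v₂ * i₁ - v₁ * i₂ = O.qref := by
  have hn : v₁ ^ 2 + v₂ ^ 2 = O.vref ^ 2 := (O.phi_eq_zero_iff hv v₁ v₂).1 hΦ
  have h2 : O.vref ^ 2 ≠ 0 := pow_ne_zero 2 hv
  obtain ⟨hp, hq⟩ := O.power_of_tracking h₁ h₂
  rw [hn, mul_div_assoc, div_self h2, mul_one] at hp hq
  exact ⟨hp, hq⟩

end Dvoc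

/-! ## §1 The multi-converter reduced-order dVOC model `f^s_v̂` -/

/-- Parameters of the `N`-converter reduced-order dVOC model [cite: SuboticEtAl2021, §VI-A eq.
(closed.loop.r.f.hatv) with §VI-C eq. (ss.f.vhat)]: uniform gains `η, η_a > 0` and rotation angle
`κ = tan⁻¹(ω₀ρ)` (Assumption 3), per-converter set-points `p_k*, q_k*, v_k*`, and the network
admittance matrix `𝒴 = ℬ Z_T⁻¹ ℬᵀ ∈ ℝ^{2N×2N}` given by its 2×2 blocks `𝒴_{kj} = Yre_{kj} I₂ + Yim_{kj} J`
(real/imaginary parts of the complex reduced admittance; `J = R(π/2)`). MODELLED: inner voltage /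
current loops ideal (`v = v̂`), line dynamics quasi-steady-state (`i_t = Z_T⁻¹ ℬᵀ v̂`), balanced,
averaged converters, constant dc voltage — MODEL-VALIDITY MV-6O (adequacy window = the source's
Conditions 4–6 / Theorem 6). -/
structure DvocNetwork (N : ℕ) where
  /-- synchronisation gain `η` -/
  η : ℝ
  /-- voltage-regulation gain `η_a` -/
  ηa : ℝ
  /-- rotation angle `κ = tan⁻¹(ω₀ ρ)` -/
  κ : ℝ
  /-- active-power set-points `p_k*` -/
  pref : Fin N → ℝ
  /-- reactive-power set-points `q_k*` -/
  qref : Fin N → ℝ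
  /-- voltage-magnitude set-points `v_k*` -/
  vref : Fin N → ℝ
  /-- real parts of the admittance blocks, `𝒴_{kj} = Yre_{kj} I₂ + Yim_{kj} J` -/
  Yre : Matrix (Fin N) (Fin N) ℝ
  /-- imaginary parts of the admittance blocks -/
  Yim : Matrix (Fin N) (Fin N) ℝ

namespace DvocNetwork

variable {N : ℕ} (W : DvocNetwork N)

/-- Converter `k` as a one-converter dVOC block `InverterDVOC.Dvoc` (same `η, η_a, κ`; its own
set-points) — the diagonal block `K_k`, `Φ_k` of `𝒦`, `Φ`. -/
def unit (k : Fin N) : Dvoc where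
  η := W.η
  ηa := W.ηa
  κ := W.κ
  pref := W.pref k
  qref := W.qref k
  vref := W.vref k

/-- State space: the stacked voltage references `v̂ = (v̂_1, …, v̂_N)`, `v̂_k = (x_k, y_k) ∈ ℝ²`, stored
as the pair of coordinate vectors `(x, y)`. -/
abbrev State (N : ℕ) : Type := (Fin N → ℝ) × (Fin N → ℝ)

/-- First component of the network current `i_{o,k} = (𝒴 v̂)_k = Σ_j (Yre_{kj} I₂ + Yim_{kj} J) v̂_j`,
with `J (a, b) = (−b, a)`: `Σ_j (Yre_{kj} x_j − Yim_{kj} y_j)` [cite: SuboticEtAl2021, §V-A, §VI-C]. -/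
def netCur₁ (v : State N) (k : Fin N) : ℝ := ∑ j, (W.Yre k j * v.1 j - W.Yim k j * v.2 j)

/-- Second component of `(𝒴 v̂)_k`: `Σ_j (Yim_{kj} x_j + Yre_{kj} y_j)`. -/
def netCur₂ (v : State N) (k : Fin N) : ℝ := ∑ j, (W.Yim k j * v.1 j + W.Yre k j * v.2 j)

/-- First component of `f^s_v̂` at converter `k` [cite: SuboticEtAl2021, eq. (ss.f.vhat)]:
the one-converter block `Dvoc.dv₁` with the output current replaced by `(𝒴 v̂)_k`. Cubic polynomial
in the `2N` state variables. -/
def dv₁ (v : State N) (k : Fin N) : ℝ :=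
  (W.unit k).dv₁ (v.1 k) (v.2 k) (W.netCur₁ v k) (W.netCur₂ v k)

/-- Second component of `f^s_v̂` at converter `k`. -/
def dv₂ (v : State N) (k : Fin N) : ℝ :=
  (W.unit k).dv₂ (v.1 k) (v.2 k) (W.netCur₁ v k) (W.netCur₂ v k)

/-- The reduced-order dVOC network field `f^s_v̂ : ℝ^{2N} → ℝ^{2N}`. -/
def field (v : State N) : State N := (fun k => W.dv₁ v k, fun k => W.dv₂ v k)

/-- Solutions of `d/dt v̂ = f^s_v̂(v̂)` on a time set `s` (tree convention). -/
def IsSolutionOn (γ : ℝ → State N) (s : Set ℝ) : Prop :=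
  ∀ t ∈ s, HasDerivWithinAt γ (W.field (γ t)) s t

/-- Active power injection `p_k = v̂_kᵀ i_{o,k}` with the quasi-steady-state current
[cite: SuboticEtAl2021, §V-B]. Quadratic polynomial. -/
def pInj (v : State N) (k : Fin N) : ℝ := v.1 k * W.netCur₁ v k + v.2 k * W.netCur₂ v k

/-- Reactive power injection `q_k = v̂_kᵀ J i_{o,k}` (`J i = (−i₂, i₁)`). Quadratic polynomial. -/
def qInj (v : State N) (k : Fin N) : ℝ := v.2 k * W.netCur₁ v k - v.1 k * W.netCur₂ v k

/-! ## §2 Rest configurations = power set-point tracking at nominal voltage -/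

/-- A configuration at which every converter is at nominal magnitude (`Φ_k = 0`) and tracks its
set-point map (`R(κ) (𝒴 v̂)_k = K_k v̂_k`) is a rest point of `f^s_v̂` (blockwise `Dvoc.rest_point`).
In the static `dq` frame such configurations come in circles (`field_rotate`). -/
theorem rest_point {v : State N}
    (hΦ : ∀ k, (W.unit k).phi (v.1 k) (v.2 k) = 0)
    (h₁ : ∀ k, cos W.κ * W.netCur₁ v k - sin W.κ * W.netCur₂ v k = (W.unit k).Kv₁ (v.1 k) (v.2 k))
    (h₂ : ∀ k, sin W.κ * W.netCur₁ v k + cos W.κ * W.netCur₂ v k = (W.unit k).Kv₂ (v.1 k) (v.2 k)) :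
    W.field v = 0 := by
  refine Prod.ext ?_ ?_
  · funext k
    exact ((W.unit k).rest_point (hΦ k) (h₁ k) (h₂ k)).1
  · funext k
    exact ((W.unit k).rest_point (hΦ k) (h₁ k) (h₂ k)).2

/-- At such a rest configuration (with `v_k* ≠ 0`) the MODEL delivers exactly the dispatched powers:
`p_k = p_k*`, `q_k = q_k*` for every converter — the operating point of [cite: SuboticEtAl2021,
§V-B] is met by construction of `K_k` and `Φ_k`. -/
theorem power_at_rest (hv : ∀ k, W.vref k ≠ 0) {v : State N}
    (hΦ : ∀ k, (W.unit k).phi (v.1 k) (v.2 k) = 0)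
    (h₁ : ∀ k, cos W.κ * W.netCur₁ v k - sin W.κ * W.netCur₂ v k = (W.unit k).Kv₁ (v.1 k) (v.2 k))
    (h₂ : ∀ k, sin W.κ * W.netCur₁ v k + cos W.κ * W.netCur₂ v k = (W.unit k).Kv₂ (v.1 k) (v.2 k))
    (k : Fin N) : W.pInj v k = W.pref k ∧ W.qInj v k = W.qref k := by
  have := (W.unit k).power_at_rest (hv k) (hΦ k) (h₁ k) (h₂ k)
  simpa [pInj, qInj, unit] using this

/-! ## §3 Rotational symmetry of `f^s_v̂` -/

/-- The global rotation `ℛ(θ) = I_N ⊗ R(θ)` acting on the stacked state: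
`(x_k, y_k) ↦ (cos θ x_k − sin θ y_k, sin θ x_k + cos θ y_k)`. -/
def rotate (θ : ℝ) (v : State N) : State N :=
  (fun k => cos θ * v.1 k - sin θ * v.2 k, fun k => sin θ * v.1 k + cos θ * v.2 k)

/-- The network current is rotation-EQUIVARIANT (its blocks `a I₂ + c J` commute with `R(θ)`). -/
theorem netCur_rotate (θ : ℝ) (v : State N) (k : Fin N) :
    W.netCur₁ (rotate θ v) k = cos θ * W.netCur₁ v k - sin θ * W.netCur₂ v k ∧
      W.netCur₂ (rotate θ v) k = sin θ * W.netCur₁ v k + cos θ * W.netCur₂ v k := by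
  constructor
  · simp only [netCur₁, netCur₂, rotate, Finset.mul_sum, ← Finset.sum_sub_distrib]
    exact Finset.sum_congr rfl fun j _ => by ring
  · simp only [netCur₁, netCur₂, rotate, Finset.mul_sum, ← Finset.sum_add_distrib]
    exact Finset.sum_congr rfl fun j _ => by ring

/-- The voltage error `Φ_k` is rotation-INVARIANT (`‖R(θ) v‖ = ‖v‖`). -/
theorem phi_rotate (θ : ℝ) (v : State N) (k : Fin N) :
    (W.unit k).phi (cos θ * v.1 k - sin θ * v.2 k) (sin θ * v.1 k + cos θ * v.2 k)
      = (W.unit k).phi (v.1 k) (v.2 k) := by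
  have sc := sin_sq_add_cos_sq θ
  simp only [Dvoc.phi]
  congr 1
  congr 1
  linear_combination (v.1 k ^ 2 + v.2 k ^ 2) * sc

/-- **Rotational symmetry.** `f^s_v̂(ℛ(θ) v̂) = ℛ(θ) f^s_v̂(v̂)` for every angle `θ`: the reduced dVOC
field commutes with the global rotation (all of `K_k`, `R(κ)`, the blocks of `𝒴` commute with
`R(θ)`; `Φ_k` is invariant). Consequence for certificates: rest points are never isolated in the
static frame (whole `ℛ(θ)`-orbits), so an SOS/Lyapunov certificate for this model is a statement
about an invariant SET (or is posed in a frame co-rotating with one converter), exactly as the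
printed result is stated «with respect to `𝒳^s(𝒮 ∩ 𝒜)`» [cite: SuboticEtAl2021, Thm. 6]. -/
theorem field_rotate (θ : ℝ) (v : State N) : W.field (rotate θ v) = rotate θ (W.field v) := by
  refine Prod.ext ?_ ?_
  · funext k
    obtain ⟨hc₁, hc₂⟩ := W.netCur_rotate θ v k
    have hΦ := W.phi_rotate θ v k
    simp only [field, dv₁, dv₂, rotate] at hc₁ hc₂ hΦ ⊢
    simp only [Dvoc.dv₁, Dvoc.dv₂, hc₁, hc₂]
    rw [hΦ]
    simp only [Dvoc.Kv₁, Dvoc.Kv₂, unit]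
    ring
  · funext k
    obtain ⟨hc₁, hc₂⟩ := W.netCur_rotate θ v k
    have hΦ := W.phi_rotate θ v k
    simp only [field, dv₁, dv₂, rotate] at hc₁ hc₂ hΦ ⊢
    simp only [Dvoc.dv₁, Dvoc.dv₂, hc₁, hc₂]
    rw [hΦ]
    simp only [Dvoc.Kv₁, Dvoc.Kv₂, unit]
    ring

/-- Hence rotations carry rest points to rest points. -/
theorem field_rotate_eq_zero {v : State N} (h : W.field v = 0) (θ : ℝ) :
    W.field (rotate θ v) = 0 := by
  rw [W.field_rotate θ v, h]
  refine Prod.ext ?_ ?_ <;> funext k <;> simp [rotate]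

end DvocNetwork

end Summit.Ventures.GridStability.Models.InverterDVOC

end
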